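import Summits.QuantumFields.YangMills.Theorems.BalabanUVNodesN15TwoGridAveragingDefect
import HarnessLib

/-!
# Route «BalabanUVNodes», node N15 = NE2, -a lane, part 46: DOOR (iv) — THE DICTIONARY `Δ_a = ρ(sLap) − V + a·Q*Q` ON REAL 1-FORMS, THE RESOLVENT SPLIT OF THE
# TWO-GRID DEFECT `G′P − PG`, AND ENTRY 0 OF `𝔇(G′, G)` FOR BAŁABAN's FULL PROPAGATOR `G = Δ_a⁻¹` MODULO THE LANDAU TERM

Cell `pub-ymgap`, seat `pub-ymgap-dag-n15-a` (KNIT-BY-NAME, g12); `--supports stmt-QuantumFields-20290 --as helper`; `HOME/pub-ymgap-dag-n15-a/DOOR-IV-PLAN.md` §7.2∕§7.4(a)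
(route R).  ASSEMBLY over parts 39 (`gOp`, `deltaOp`, `gOp_comp_deltaOp`, `deltaOp_comp_gOp`), 42 (`Lap_mulVec_ofReal`), 37 (`QvOp_mulVec_ofReal_re`, `QvAdj_mulVec_ofReal_re`),
43 (`hasMaj_lapDefect`, `hasMaj_swapLapDefect`), 44 (`hasMaj_outputSwap`), 45 (`hasMaj_averagingDefect`) and lit-balaban's defect calculus `T4EtaRateDefect.idef`∕`idef_inv`.
WHAT.  (§38) The Landau-gauge term `V = ∂Π∂*` of `Δ_a = Δ − ∂Π∂* + aQ*Q` ((1.69); `Π = B5Value126.PcT` (1.26)∕(1.70)) as a REAL linear operator `landauRe` (`Matrix.mulVecLin ∘ reM`,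
real by `isReal_GradOp`∕`isReal_PcT`), and the DICTIONARY ★ `deltaOp_eq`: `deltaOp M n a = ρ(sLap n) − landauRe M n + a•(qvAdjRe M n ∘ qvRe M n)` — part 39's `deltaOp`
(`mulVecLin DeltaAR`) IS the symbol-calculus Laplacian of parts 35∕42 minus the Landau operator plus `a` times part 37's real averaging operators.  (§39) The RESOLVENT SPLIT,
pointwise: `𝔇(G′,G) := idef P P G′ G = G′P − PG = −G′(Δ′P̂₂ − P̂₂Δ)G − G′(P̂₂ − P)ΔG + G′(V′P̂₂ − PV)G − a·G′(Q′*Q′P̂₂ − PQ*Q)G + (P̂₂ − P)G` (`idef_inv` with `G′Δ′_a = 1`,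
`Δ_aG = 1`, then `deltaOp_eq` on both grids) — ★ `twoGridDefect_split_apply`.  (§40) ★★ **`hasMaj_twoGridDefect_of_landau`**: for odd `L > 1`, `a > 0`, `0 ≤ α < 1`, IF the
Landau sandwich `G′∘(V′∘P̂₂ − P∘V)∘G` has a block majorant `C_V·(L^k)^{−α}·e^{−δ_V|y−y′|_T}` on the torus family of record, THEN `𝔇(G′, G) = idef P P G′ G` has a block majorant
`C·(L^k)^{−α}·e^{−δ|y−y′|_T}` (parts 43∕44∕45 supply the other four terms HYPOTHESIS-FREE; `(L^k)⁻¹ ≤ (L^k)^{−α}`); and `hasMaj_twoGridDefect_of_landau_kingPrV`, the same in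
part 15's target-block convention `blkFine ∘ kingPrV` (= ENTRY 0 of (3.42) for the pair `(G′, G)` in the lineage's `HasMaj` currency, the input of n15-b's `OperatorReadout`).
HONEST FRAMING ∕ LIMITS.  CONDITIONAL on the Landau term (plan §7.4(a): the η-rate of the (1.126) kernel `∂Π∂*` is NOT in printed currency — the located hard core; no claim about
it here); entries 1–3 of (3.42) and the node readout are NOT here; constants crude and ours; Bałaban's inequalities enter only through the tree's theorem `prop12_famG_printed`;
tori of record `M_μ = 2L^{m_T}`; `U ≡ 1`; count-neutral (typed 28∕28 · discharged 5∕28 unchanged); NOT a discharge of N15 (object-bound; NE2⁺ NOT PRINTED); one finite T⁴ at fixed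
ε — NOT infinite volume, NOT OS on ℝ⁴, NOT a mass gap, NOT Clay.
-/

noncomputable section

open scoped BigOperators Matrix
open Finset

namespace Summit.QuantumFields.YangMills.BalabanUVNodes.N15.TwoGrid

open Literature.MathematicalPhysics.QuantumFieldTheory.Balaban1983to89
open Literature.MathematicalPhysics.QuantumFieldTheory.Balaban1983to89.B11SectG (BlockNorm HasMaj)
open Literature.MathematicalPhysics.QuantumFieldTheory.Balaban1983to89.T4EtaRateCoeffDefect (pull pull_apply)
open Literature.MathematicalPhysics.QuantumFieldTheory.Balaban1983to89.T4EtaRateDefect (idef idef_apply)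
open Literature.MathematicalPhysics.QuantumFieldTheory.Balaban1983to89.B5Prop11Plancherel (Tor fine unitVec)
open Literature.MathematicalPhysics.QuantumFieldTheory.Balaban1983to89.B5Action121 (GradOp)
open Literature.MathematicalPhysics.QuantumFieldTheory.Balaban1983to89.B5Value126 (PcT)
open Literature.MathematicalPhysics.QuantumFieldTheory.Balaban1983to89.B5Prop11Lower (Lap)
open Literature.MathematicalPhysics.QuantumFieldTheory.Balaban1983to89.B5Block118 (QvOp)
open Literature.MathematicalPhysics.QuantumFieldTheory.Balaban1983to89.B5DeltaA169 (DeltaA QvAdj)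
open Literature.MathematicalPhysics.QuantumFieldTheory.Balaban1983to89.B5RealFields (IsReal reM cplx DeltaAR isReal_GradOp isReal_PcT isReal_Lap isReal_QvOp isReal_QvAdj
  reM_add reM_sub reM_smul_ofReal)
open Literature.MathematicalPhysics.QuantumFieldTheory.Balaban1983to89.B5SettingP12Real (latticeSettingP12R)
open Literature.MathematicalPhysics.QuantumFieldTheory.Balaban1983to89.B5SiteBridgeP12 (MP)
open Literature.MathematicalPhysics.QuantumFieldTheory.King1986.Torus (blockOf tdistT tdistT_nonneg)
open Literature.MathematicalPhysics.QuantumFieldTheory.Balaban1983to89.B6UnitTorusCarrier (unitTorusGeo)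
open Summit.QuantumFields.YangMills.BalabanUVNodes.N15.VectorPiece (blkFine blkFine_apply kingPrV kingPrV_eq blkFine_comp_kingPrV)

variable {d : ℕ}

/-! ## §38 The Landau term `V = ∂Π∂*` on real 1-forms and the dictionary `Δ_a = ρ(sLap) − V + a·Q*Q` -/

section Dictionary

variable (M : Fin (d + 1) → ℕ) [∀ μ, NeZero (M μ)] (n : ℕ) [NeZero n] (a : ℝ)

/-- **THE LANDAU-GAUGE TERM `V = ∂Π∂*` OF `Δ_a` ON REAL 1-FORMS**: `Matrix.mulVecLin (reM (∂·Π·∂ᴴ))`, `∂ = GradOp (fine n M) n` (1.4), `Π = PcT n M n` = `Δ⁻¹Q′*(Q′Δ⁻²Q′*)⁻¹Q′Δ⁻¹`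
(1.26)∕(1.70). [cite: Balaban1984PropagatorsI, (1.69) p.29, (1.70) p.30] -/
def landauRe : (Tor (fine n M) × Fin (d + 1) → ℝ) →ₗ[ℝ] (Tor (fine n M) × Fin (d + 1) → ℝ) :=
  Matrix.mulVecLin (reM (GradOp (fine n M) (n : ℂ) * PcT n M (n : ℂ) * (GradOp (fine n M) (n : ℂ))ᴴ))

/-- `∂Π∂*` is a real matrix. [cite: Balaban1984PropagatorsI, (1.69) p.29 (typed reading)] -/
theorem isReal_landauMatrix : IsReal (GradOp (fine n M) (n : ℂ) * PcT n M (n : ℂ) * (GradOp (fine n M) (n : ℂ))ᴴ) := by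
  have hn : (starRingEnd ℂ) (n : ℂ) = n := map_natCast _ n
  exact ((isReal_GradOp (fine n M) hn).mul (isReal_PcT n M hn)).mul (isReal_GradOp (fine n M) hn).conjTranspose

omit [∀ μ, NeZero (M μ)] [NeZero n] in
/-- the real part of a complex matrix acts on a real vector as the real part of the complex action on its embedding. [folklore] -/
theorem reM_mulVec_apply {m k : Type} [Fintype k] (A : Matrix m k ℂ) (u : k → ℝ) (i : m) :
    (reM A *ᵥ u) i = ((A *ᵥ fun j => ((u j : ℝ) : ℂ)) i).re := by
  simp only [Matrix.mulVec, dotProduct, B5RealFields.reM_apply, Complex.re_sum, Complex.mul_re, Complex.ofReal_re, Complex.ofReal_im, mul_zero,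
    sub_zero]

/-- `reM (Lap)` acts as the symbol-calculus Laplacian `ρ(sLap n)` (part 42's `Lap_mulVec_ofReal`). [cite: Balaban1984PropagatorsI, (1.21) p.21] -/
theorem reM_Lap_mulVec (u : Tor (fine n M) × Fin (d + 1) → ℝ) : reM (Lap n M) *ᵥ u = symbOp M n (sLap M n n) u := by
  funext i
  rw [reM_mulVec_apply, Lap_mulVec_ofReal, Complex.ofReal_re]

/-- `reM (Q_k)` acts as part 37's `qvRe`. [cite: Balaban1984PropagatorsI, (1.18) p.20] -/
theorem reM_QvOp_mulVec (u : Tor (fine n M) × Fin (d + 1) → ℝ) : reM (QvOp n M) *ᵥ u = qvRe M n u := by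
  funext b
  rw [reM_mulVec_apply, QvOp_mulVec_ofReal_re]

/-- `reM (Q*_k)` acts as part 37's `qvAdjRe`. [cite: Balaban1984PropagatorsI, (1.18) p.20, (1.69) p.29] -/
theorem reM_QvAdj_mulVec (v : Tor M × Fin (d + 1) → ℝ) : reM (QvAdj n M) *ᵥ v = qvAdjRe M n v := by
  funext i
  rw [reM_mulVec_apply, QvAdj_mulVec_ofReal_re]

/-- `reM (Q*_kQ_k)` acts as `qvAdjRe ∘ qvRe` (both factors real). [cite: Balaban1984PropagatorsI, (1.69) p.29] -/
theorem reM_QvAdj_mul_QvOp_mulVec (u : Tor (fine n M) × Fin (d + 1) → ℝ) : reM (QvAdj n M * QvOp n M) *ᵥ u = qvAdjRe M n (qvRe M n u) := by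
  rw [(isReal_QvAdj n M).reM_mul (isReal_QvOp n M), ← Matrix.mulVec_mulVec, reM_QvOp_mulVec, reM_QvAdj_mulVec]

/-- ★ **THE DICTIONARY `Δ_a = ρ(sLap) − V + a·Q*Q` ON REAL 1-FORMS**: part 39's `deltaOp M n a = mulVecLin (reM Δ_a)` equals the symbol-calculus Laplacian `ρ(sLap n)` (parts 35∕42) minus
the Landau operator `landauRe` plus `a` times part 37's `qvAdjRe ∘ qvRe` — the literal (1.69)∕(1.73) `Δ_a = Δ − ∂P∂* + aQ*Q` read on real 1-forms. [cite: Balaban1984PropagatorsI, (1.69) p.29, (1.73) p.30] -/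
theorem deltaOp_eq : deltaOp M n a = symbOp M n (sLap M n n) - landauRe M n + a • (qvAdjRe M n ∘ₗ qvRe M n) := by
  refine LinearMap.ext fun u => ?_
  rw [deltaOp, Matrix.mulVecLin_apply, DeltaAR, DeltaA, reM_add, reM_sub, reM_smul_ofReal, Matrix.add_mulVec, Matrix.sub_mulVec, Matrix.smul_mulVec,
    reM_Lap_mulVec, reM_QvAdj_mul_QvOp_mulVec, LinearMap.add_apply, LinearMap.sub_apply, LinearMap.smul_apply, LinearMap.comp_apply, landauRe,
    Matrix.mulVecLin_apply]

end Dictionary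

/-! ## §39 The resolvent split of the two-grid defect `G′P − PG`, pointwise -/

section Split

variable {L : ℕ} [NeZero L] (M : Fin (d + 1) → ℕ) [∀ μ, NeZero (M μ)] (k m : ℕ) (a : ℝ)

/-- ★ **THE RESOLVENT SPLIT OF `𝔇(G′, G) = G′P − PG`** (plan §7.2, split (A) + `idef_inv` + `deltaOp_eq` on both grids): with `u := Gμ`, `P̂₂ = ρ′(Π_νa_ν²)∘P`,
`(G′P − PG)μ = −G′[(Δ′P̂₂ − P̂₂Δ)u] − G′[(P̂₂ − P)(Δu)] + G′[(V′P̂₂ − PV)u] − a·G′[(Q′*Q′P̂₂ − PQ*Q)u] + (P̂₂ − P)u` — the operators of parts 43 (`hasMaj_lapDefect`,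
`hasMaj_swapLapDefect`), §40's Landau hypothesis, part 45 (`hasMaj_averagingDefect`) and part 44 (`hasMaj_outputSwap`) (`k ≥ 0`, `L ≥ 1`, `a > 0` for `G′Δ′_a = 1`, `Δ_aG = 1`).
[cite: Balaban1984PropagatorsI, (1.69)–(1.73) pp.29–30; King1986, (3.73) p.672 (the resolvent mechanism)] -/
theorem twoGridDefect_split_apply (ha : 0 < a) (μ : Tor (fine (L ^ k) M) × Fin (d + 1) → ℝ) :
    idef (pull (kingPrV L k m M)) (pull (kingPrV L k m M)) (gOp M (L ^ m * L ^ k) a) (gOp M (L ^ k) a) μ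
      = -((gOp M (L ^ m * L ^ k) a ∘ₗ
            ((symbOp M (L ^ m * L ^ k) (sLap M (L ^ m * L ^ k) ((L ^ m * L ^ k : ℕ) : ℝ)) ∘ₗ (symbOp M (L ^ m * L ^ k) (sSm M (L ^ m * L ^ k) (L ^ m)) ∘ₗ pull (kingPrV L k m M)) -
                symbOp M (L ^ m * L ^ k) (sSm M (L ^ m * L ^ k) (L ^ m)) ∘ₗ (pull (kingPrV L k m M) ∘ₗ symbOp M (L ^ k) (sLap M (L ^ k) ((L ^ k : ℕ) : ℝ)))) ∘ₗ
              gOp M (L ^ k) a)) μ)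
        - (gOp M (L ^ m * L ^ k) a ∘ₗ ((symbOp M (L ^ m * L ^ k) (sSm M (L ^ m * L ^ k) (L ^ m)) ∘ₗ pull (kingPrV L k m M) - pull (kingPrV L k m M)) ∘ₗ
            (symbOp M (L ^ k) (sLap M (L ^ k) ((L ^ k : ℕ) : ℝ)) ∘ₗ gOp M (L ^ k) a))) μ
        + (gOp M (L ^ m * L ^ k) a ∘ₗ ((landauRe M (L ^ m * L ^ k) ∘ₗ symbOp M (L ^ m * L ^ k) (sSm M (L ^ m * L ^ k) (L ^ m)) ∘ₗ pull (kingPrV L k m M)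
            - pull (kingPrV L k m M) ∘ₗ landauRe M (L ^ k)) ∘ₗ gOp M (L ^ k) a)) μ
        - a • (gOp M (L ^ m * L ^ k) a ∘ₗ ((qvAdjRe M (L ^ m * L ^ k) ∘ₗ qvRe M (L ^ m * L ^ k) ∘ₗ symbOp M (L ^ m * L ^ k) (sSm M (L ^ m * L ^ k) (L ^ m)) ∘ₗ
              pull (kingPrV L k m M) - pull (kingPrV L k m M) ∘ₗ qvAdjRe M (L ^ k) ∘ₗ qvRe M (L ^ k)) ∘ₗ gOp M (L ^ k) a)) μ
        + ((symbOp M (L ^ m * L ^ k) (sSm M (L ^ m * L ^ k) (L ^ m)) ∘ₗ pull (kingPrV L k m M) - pull (kingPrV L k m M)) ∘ₗ gOp M (L ^ k) a) μ := by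
  have hL0 : 0 < L := Nat.pos_of_ne_zero (NeZero.ne L)
  have hn1 : 1 ≤ L ^ k := Nat.one_le_pow _ _ hL0
  have hn'1 : 1 ≤ L ^ m * L ^ k := Nat.one_le_iff_ne_zero.mpr (Nat.mul_ne_zero (by positivity) (by positivity))
  -- `G′Δ′_a = 1`, `Δ_aG = 1`
  have h1 : ∀ x, gOp M (L ^ m * L ^ k) a (deltaOp M (L ^ m * L ^ k) a x) = x := fun x => by
    simpa using LinearMap.congr_fun (gOp_comp_deltaOp M (L ^ m * L ^ k) a hn'1 ha) x
  have h2 : deltaOp M (L ^ k) a (gOp M (L ^ k) a μ) = μ := by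
    simpa using LinearMap.congr_fun (deltaOp_comp_gOp M (L ^ k) a hn1 ha) μ
  set u := gOp M (L ^ k) a μ with hu
  set G' := gOp M (L ^ m * L ^ k) a with hG'
  set Ph := symbOp M (L ^ m * L ^ k) (sSm M (L ^ m * L ^ k) (L ^ m)) ∘ₗ pull (kingPrV L k m M) with hPh
  -- `G′Pμ − P̂₂u = −G′[Δ′_a(P̂₂u) − P(Δ_au)]`
  have hres : G' (pull (kingPrV L k m M) μ) - pull (kingPrV L k m M) u =
      -(G' (deltaOp M (L ^ m * L ^ k) a (Ph u) - pull (kingPrV L k m M) (deltaOp M (L ^ k) a u))) + (Ph u - pull (kingPrV L k m M) u) := by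
    rw [map_sub, h1, h2]; abel
  rw [idef_apply, hres, deltaOp_eq, deltaOp_eq]
  simp only [LinearMap.comp_apply, LinearMap.sub_apply, LinearMap.add_apply, LinearMap.smul_apply, map_sub, map_add, map_smul, hPh, smul_sub]
  abel

end Split

/-! ## §40 ★★ ENTRY 0 OF `𝔇(G′, G)` MODULO THE LANDAU TERM -/

section Entry0

variable {L : ℕ} [NeZero L]

/-- **CORE BOOKKEEPING (one torus, arbitrary kernels)**: block majorants `K₁, K₂, K_V, K₃, K₄` for the five sandwiches of the resolvent split (§39) give the majorant
`K₁ + K₂ + K_V + |a|·K₃ + K₄` for `𝔇(G′, G) = idef P P G′ G`. [folklore] -/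
theorem hasMaj_twoGridDefect_core (M : Fin (d + 1) → ℕ) [∀ μ, NeZero (M μ)] (k m : ℕ) {a : ℝ} (ha : 0 < a)
    {b₁ : BlockNorm (unitTorusGeo L k M) (Tor (fine (L ^ k) M) × Fin (d + 1) → ℝ)} {K₁ K₂ KV K₃ K₄ : Tor M → Tor M → ℝ} (hK₃ : ∀ y y', 0 ≤ K₃ y y')
    (h₁ : HasMaj b₁ (BlockNorm.ofBlocks (unitTorusGeo L k M) (fun i : Tor (fine (L ^ m * L ^ k) M) × Fin (d + 1) => blockOf (L ^ m * L ^ k) M i.1))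
      (gOp M (L ^ m * L ^ k) a ∘ₗ
        ((symbOp M (L ^ m * L ^ k) (sLap M (L ^ m * L ^ k) ((L ^ m * L ^ k : ℕ) : ℝ)) ∘ₗ (symbOp M (L ^ m * L ^ k) (sSm M (L ^ m * L ^ k) (L ^ m)) ∘ₗ pull (kingPrV L k m M)) -
            symbOp M (L ^ m * L ^ k) (sSm M (L ^ m * L ^ k) (L ^ m)) ∘ₗ (pull (kingPrV L k m M) ∘ₗ symbOp M (L ^ k) (sLap M (L ^ k) ((L ^ k : ℕ) : ℝ)))) ∘ₗ
          gOp M (L ^ k) a)) K₁)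
    (h₂ : HasMaj b₁ (BlockNorm.ofBlocks (unitTorusGeo L k M) (fun i : Tor (fine (L ^ m * L ^ k) M) × Fin (d + 1) => blockOf (L ^ m * L ^ k) M i.1))
      (gOp M (L ^ m * L ^ k) a ∘ₗ ((symbOp M (L ^ m * L ^ k) (sSm M (L ^ m * L ^ k) (L ^ m)) ∘ₗ pull (kingPrV L k m M) - pull (kingPrV L k m M)) ∘ₗ
        (symbOp M (L ^ k) (sLap M (L ^ k) ((L ^ k : ℕ) : ℝ)) ∘ₗ gOp M (L ^ k) a))) K₂)
    (hV : HasMaj b₁ (BlockNorm.ofBlocks (unitTorusGeo L k M) (fun i : Tor (fine (L ^ m * L ^ k) M) × Fin (d + 1) => blockOf (L ^ m * L ^ k) M i.1))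
      (gOp M (L ^ m * L ^ k) a ∘ₗ ((landauRe M (L ^ m * L ^ k) ∘ₗ symbOp M (L ^ m * L ^ k) (sSm M (L ^ m * L ^ k) (L ^ m)) ∘ₗ pull (kingPrV L k m M)
        - pull (kingPrV L k m M) ∘ₗ landauRe M (L ^ k)) ∘ₗ gOp M (L ^ k) a)) KV)
    (h₃ : HasMaj b₁ (BlockNorm.ofBlocks (unitTorusGeo L k M) (fun i : Tor (fine (L ^ m * L ^ k) M) × Fin (d + 1) => blockOf (L ^ m * L ^ k) M i.1))
      (gOp M (L ^ m * L ^ k) a ∘ₗ ((qvAdjRe M (L ^ m * L ^ k) ∘ₗ qvRe M (L ^ m * L ^ k) ∘ₗ symbOp M (L ^ m * L ^ k) (sSm M (L ^ m * L ^ k) (L ^ m)) ∘ₗ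
        pull (kingPrV L k m M) - pull (kingPrV L k m M) ∘ₗ qvAdjRe M (L ^ k) ∘ₗ qvRe M (L ^ k)) ∘ₗ gOp M (L ^ k) a)) K₃)
    (h₄ : HasMaj b₁ (BlockNorm.ofBlocks (unitTorusGeo L k M) (fun i : Tor (fine (L ^ m * L ^ k) M) × Fin (d + 1) => blockOf (L ^ m * L ^ k) M i.1))
      (((symbOp M (L ^ m * L ^ k) (sSm M (L ^ m * L ^ k) (L ^ m)) ∘ₗ pull (kingPrV L k m M) - pull (kingPrV L k m M)) ∘ₗ gOp M (L ^ k) a)) K₄) :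
    HasMaj b₁ (BlockNorm.ofBlocks (unitTorusGeo L k M) (fun i : Tor (fine (L ^ m * L ^ k) M) × Fin (d + 1) => blockOf (L ^ m * L ^ k) M i.1))
      (idef (pull (kingPrV L k m M)) (pull (kingPrV L k m M)) (gOp M (L ^ m * L ^ k) a) (gOp M (L ^ k) a))
      (fun y y' => K₁ y y' + K₂ y y' + KV y y' + |a| * K₃ y y' + K₄ y y') := by
  have g3 := hasMaj_smul_ofBlocks (g := unitTorusGeo L k M) (fun i : Tor (fine (L ^ m * L ^ k) M) × Fin (d + 1) => blockOf (L ^ m * L ^ k) M i.1) hK₃ a h₃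
  refine ((((h₁.neg.sub h₂).add hV).sub g3).add h₄).congr fun μ => ?_
  rw [LinearMap.add_apply, LinearMap.sub_apply, LinearMap.add_apply, LinearMap.sub_apply, LinearMap.neg_apply, LinearMap.smul_apply,
    twoGridDefect_split_apply M k m a ha μ]

/-- ★★ **ENTRY 0 OF THE TWO-GRID DEFECT OF BAŁABAN's FULL PROPAGATOR, MODULO THE LANDAU TERM.**  For odd `L > 1`, `a > 0`, `0 ≤ α < 1`: IF on the torus family of record the
Landau sandwich `G′∘(V′∘P̂₂ − P∘V)∘G` (`V = landauRe = ∂Π∂*`) has a block majorant `C_V·(L^k)^{−α}·e^{−δ_V|y−y′|_T}` (some `δ_V, C_V > 0`, all `m_T, k ≥ 1, m`), THEN there are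
`δ, C > 0` with `HasMaj (ofBlocks … blkFine) (ofBlocks … blockOf_{L^m·L^k}) (idef P P G′ G) (C·(L^k)^{−α}·e^{−δ|y−y′|_T})` for all `m_T, k ≥ 1, m` — `𝔇(G′, G) = G′P − PG` through
King's prolongation, i.e. entry 0 of (3.42) for `(G′, G)`.  The four other terms of the resolvent split (§39) are the tree's HYPOTHESIS-FREE parts 43 (`η^α`, `η`), 44 (`η`), 45 (`η`);
`η ≤ η^α`. [cite: Balaban1984PropagatorsI, Prop. 1.2 (1.110)–(1.111) p.35; Balaban1985BackgroundPropagators, (3.42) p.397 (first entry, shape); King1986, Prop. 3.9 p.664 (η-rate shape)] -/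
theorem hasMaj_twoGridDefect_of_landau (hL : Odd L ∧ 1 < L) {a : ℝ} (ha : 0 < a) {α : ℝ} (hα0 : 0 ≤ α) (hα1 : α < 1) {δV CV : ℝ} (hδV : 0 < δV) (hCV : 0 < CV)
    (hV : ∀ (mT k m : ℕ) (hk : 1 ≤ k),
      HasMaj (BlockNorm.ofBlocks (unitTorusGeo L k (MP (paramsOf d L mT k hL))) (blkFine L k (MP (paramsOf d L mT k hL))))
        (BlockNorm.ofBlocks (unitTorusGeo L k (MP (paramsOf d L mT k hL)))
          (fun i : Tor (fine (L ^ m * L ^ k) (MP (paramsOf d L mT k hL))) × Fin (d + 1) => blockOf (L ^ m * L ^ k) (MP (paramsOf d L mT k hL)) i.1))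
        (gOp (MP (paramsOf d L mT k hL)) (L ^ m * L ^ k) a ∘ₗ
          ((landauRe (MP (paramsOf d L mT k hL)) (L ^ m * L ^ k) ∘ₗ
              symbOp (MP (paramsOf d L mT k hL)) (L ^ m * L ^ k) (sSm (MP (paramsOf d L mT k hL)) (L ^ m * L ^ k) (L ^ m)) ∘ₗ pull (kingPrV L k m (MP (paramsOf d L mT k hL)))
            - pull (kingPrV L k m (MP (paramsOf d L mT k hL))) ∘ₗ landauRe (MP (paramsOf d L mT k hL)) (L ^ k)) ∘ₗ gOp (MP (paramsOf d L mT k hL)) (L ^ k) a))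
        (fun y y' => CV * ((L ^ k : ℕ) : ℝ) ^ (-α) * Real.exp (-(δV * tdistT (MP (paramsOf d L mT k hL)) y y')))) :
    ∃ δ C : ℝ, 0 < δ ∧ 0 < C ∧ ∀ (mT k m : ℕ) (hk : 1 ≤ k),
      HasMaj (BlockNorm.ofBlocks (unitTorusGeo L k (MP (paramsOf d L mT k hL))) (blkFine L k (MP (paramsOf d L mT k hL))))
        (BlockNorm.ofBlocks (unitTorusGeo L k (MP (paramsOf d L mT k hL)))
          (fun i : Tor (fine (L ^ m * L ^ k) (MP (paramsOf d L mT k hL))) × Fin (d + 1) => blockOf (L ^ m * L ^ k) (MP (paramsOf d L mT k hL)) i.1))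
        (idef (pull (kingPrV L k m (MP (paramsOf d L mT k hL)))) (pull (kingPrV L k m (MP (paramsOf d L mT k hL))))
          (gOp (MP (paramsOf d L mT k hL)) (L ^ m * L ^ k) a) (gOp (MP (paramsOf d L mT k hL)) (L ^ k) a))
        (fun y y' => C * ((L ^ k : ℕ) : ℝ) ^ (-α) * Real.exp (-(δ * tdistT (MP (paramsOf d L mT k hL)) y y'))) := by
  obtain ⟨δ₁, C₁, hδ₁, hC₁, H1⟩ := hasMaj_lapDefect (d := d) hL ha hα0 hα1
  obtain ⟨δ₂, C₂, hδ₂, hC₂, H2⟩ := hasMaj_swapLapDefect (d := d) hL ha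
  obtain ⟨δ₃, C₃, hδ₃, hC₃, H3⟩ := hasMaj_averagingDefect (d := d) hL ha
  obtain ⟨δ₄, C₄, hδ₄, hC₄, H4⟩ := hasMaj_outputSwap (d := d) hL ha
  set δ := min (min (min δ₁ δ₂) (min δ₃ δ₄)) δV with hδ
  have hδpos : 0 < δ := lt_min (lt_min (lt_min hδ₁ hδ₂) (lt_min hδ₃ hδ₄)) hδV
  have hδ1 : δ ≤ δ₁ := (min_le_left _ _).trans ((min_le_left _ _).trans (min_le_left _ _))
  have hδ2 : δ ≤ δ₂ := (min_le_left _ _).trans ((min_le_left _ _).trans (min_le_right _ _))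
  have hδ3 : δ ≤ δ₃ := (min_le_left _ _).trans ((min_le_right _ _).trans (min_le_left _ _))
  have hδ4 : δ ≤ δ₄ := (min_le_left _ _).trans ((min_le_right _ _).trans (min_le_right _ _))
  have hδV' : δ ≤ δV := min_le_right _ _
  refine ⟨δ, C₁ + C₂ + CV + |a| * C₃ + C₄, hδpos, by positivity, fun mT k m hk => ?_⟩
  have hL0 : 0 < L := Nat.pos_of_ne_zero (NeZero.ne L)
  have hn1 : (1 : ℝ) ≤ ((L ^ k : ℕ) : ℝ) := by exact_mod_cast Nat.one_le_pow _ _ hL0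
  have hn0 : (0 : ℝ) < ((L ^ k : ℕ) : ℝ) := by linarith
  have hrα : 0 ≤ ((L ^ k : ℕ) : ℝ) ^ (-α) := Real.rpow_nonneg hn0.le _
  -- `(L^k)⁻¹ ≤ (L^k)^{−α}` and `e^{−δ_i d} ≤ e^{−δ d}`
  have hinv : ((L ^ k : ℕ) : ℝ)⁻¹ ≤ ((L ^ k : ℕ) : ℝ) ^ (-α) := by
    rw [← Real.rpow_neg_one]
    exact Real.rpow_le_rpow_of_exponent_le hn1 (by linarith)
  have hexp : ∀ {δ' : ℝ}, δ ≤ δ' → ∀ y y' : Tor (MP (paramsOf d L mT k hL)), Real.exp (-(δ' * tdistT (MP (paramsOf d L mT k hL)) y y')) ≤ Real.exp (-(δ * tdistT (MP (paramsOf d L mT k hL)) y y')) := fun hle y y' =>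
    Real.exp_le_exp.mpr (by nlinarith [tdistT_nonneg (MP (paramsOf d L mT k hL)) y y'])
  have mono1 : ∀ {Cc δ' : ℝ}, 0 ≤ Cc → δ ≤ δ' → ∀ y y' : Tor (MP (paramsOf d L mT k hL)), Cc * ((L ^ k : ℕ) : ℝ)⁻¹ * Real.exp (-(δ' * tdistT (MP (paramsOf d L mT k hL)) y y')) ≤ Cc * ((L ^ k : ℕ) : ℝ) ^ (-α) * Real.exp (-(δ * tdistT (MP (paramsOf d L mT k hL)) y y')) :=
    fun hC hle y y' => mul_le_mul (mul_le_mul_of_nonneg_left hinv hC) (hexp hle y y') (Real.exp_nonneg _) (mul_nonneg hC hrα)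
  have monoα : ∀ {Cc δ' : ℝ}, 0 ≤ Cc → δ ≤ δ' → ∀ y y' : Tor (MP (paramsOf d L mT k hL)), Cc * ((L ^ k : ℕ) : ℝ) ^ (-α) * Real.exp (-(δ' * tdistT (MP (paramsOf d L mT k hL)) y y')) ≤ Cc * ((L ^ k : ℕ) : ℝ) ^ (-α) * Real.exp (-(δ * tdistT (MP (paramsOf d L mT k hL)) y y')) :=
    fun hC hle y y' => mul_le_mul_of_nonneg_left (hexp hle y y') (mul_nonneg hC hrα)
  have hK3 : ∀ y y' : Tor (MP (paramsOf d L mT k hL)), 0 ≤ C₃ * ((L ^ k : ℕ) : ℝ)⁻¹ * Real.exp (-(δ₃ * tdistT (MP (paramsOf d L mT k hL)) y y')) :=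
    fun y y' => mul_nonneg (mul_nonneg hC₃.le (inv_nonneg.mpr hn0.le)) (Real.exp_nonneg _)
  refine (hasMaj_twoGridDefect_core (MP (paramsOf d L mT k hL)) k m ha hK3 (H1 mT k m hk) (H2 mT k m hk) (hV mT k m hk) (H3 mT k m hk) (H4 mT k m hk)).mono
    fun y y' => ?_
  have e1 := monoα hC₁.le hδ1 y y'
  have e2 := mono1 hC₂.le hδ2 y y'
  have eV := monoα hCV.le hδV' y y'
  have e3 := mono1 hC₃.le hδ3 y y'
  have e4 := mono1 hC₄.le hδ4 y y'
  have ha0 : 0 ≤ |a| := abs_nonneg a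
  have e3' := mul_le_mul_of_nonneg_left e3 ha0
  calc C₁ * ((L ^ k : ℕ) : ℝ) ^ (-α) * Real.exp (-(δ₁ * tdistT (MP (paramsOf d L mT k hL)) y y'))
        + C₂ * ((L ^ k : ℕ) : ℝ)⁻¹ * Real.exp (-(δ₂ * tdistT (MP (paramsOf d L mT k hL)) y y'))
        + CV * ((L ^ k : ℕ) : ℝ) ^ (-α) * Real.exp (-(δV * tdistT (MP (paramsOf d L mT k hL)) y y'))
        + |a| * (C₃ * ((L ^ k : ℕ) : ℝ)⁻¹ * Real.exp (-(δ₃ * tdistT (MP (paramsOf d L mT k hL)) y y')))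
        + C₄ * ((L ^ k : ℕ) : ℝ)⁻¹ * Real.exp (-(δ₄ * tdistT (MP (paramsOf d L mT k hL)) y y'))
      ≤ C₁ * ((L ^ k : ℕ) : ℝ) ^ (-α) * Real.exp (-(δ * tdistT (MP (paramsOf d L mT k hL)) y y'))
        + C₂ * ((L ^ k : ℕ) : ℝ) ^ (-α) * Real.exp (-(δ * tdistT (MP (paramsOf d L mT k hL)) y y'))
        + CV * ((L ^ k : ℕ) : ℝ) ^ (-α) * Real.exp (-(δ * tdistT (MP (paramsOf d L mT k hL)) y y'))
        + |a| * (C₃ * ((L ^ k : ℕ) : ℝ) ^ (-α) * Real.exp (-(δ * tdistT (MP (paramsOf d L mT k hL)) y y')))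
        + C₄ * ((L ^ k : ℕ) : ℝ) ^ (-α) * Real.exp (-(δ * tdistT (MP (paramsOf d L mT k hL)) y y')) := by linarith
    _ = (C₁ + C₂ + CV + |a| * C₃ + C₄) * ((L ^ k : ℕ) : ℝ) ^ (-α) * Real.exp (-(δ * tdistT (MP (paramsOf d L mT k hL)) y y')) := by ring

/-- **THE SAME IN PART 15's TARGET-BLOCK CONVENTION** (`blkFine ∘ kingPrV`, the shape of `VectorPiece.hasMaj_entry0` and of n15-b's `OperatorReadout` inputs): the fine bonds blocked through
King's pairing, `B(pr x′) = B′(x′)` (`blkFine_comp_kingPrV`). [cite: Balaban1985BackgroundPropagators, (3.42) p.397 (first entry, shape); King1986, Prop. 3.9 p.664] -/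
theorem hasMaj_twoGridDefect_of_landau_kingPrV (hL : Odd L ∧ 1 < L) {a : ℝ} (ha : 0 < a) {α : ℝ} (hα0 : 0 ≤ α) (hα1 : α < 1) {δV CV : ℝ} (hδV : 0 < δV) (hCV : 0 < CV)
    (hV : ∀ (mT k m : ℕ) (hk : 1 ≤ k),
      HasMaj (BlockNorm.ofBlocks (unitTorusGeo L k (MP (paramsOf d L mT k hL))) (blkFine L k (MP (paramsOf d L mT k hL))))
        (BlockNorm.ofBlocks (unitTorusGeo L k (MP (paramsOf d L mT k hL)))
          (fun i : Tor (fine (L ^ m * L ^ k) (MP (paramsOf d L mT k hL))) × Fin (d + 1) => blockOf (L ^ m * L ^ k) (MP (paramsOf d L mT k hL)) i.1))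
        (gOp (MP (paramsOf d L mT k hL)) (L ^ m * L ^ k) a ∘ₗ
          ((landauRe (MP (paramsOf d L mT k hL)) (L ^ m * L ^ k) ∘ₗ
              symbOp (MP (paramsOf d L mT k hL)) (L ^ m * L ^ k) (sSm (MP (paramsOf d L mT k hL)) (L ^ m * L ^ k) (L ^ m)) ∘ₗ pull (kingPrV L k m (MP (paramsOf d L mT k hL)))
            - pull (kingPrV L k m (MP (paramsOf d L mT k hL))) ∘ₗ landauRe (MP (paramsOf d L mT k hL)) (L ^ k)) ∘ₗ gOp (MP (paramsOf d L mT k hL)) (L ^ k) a))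
        (fun y y' => CV * ((L ^ k : ℕ) : ℝ) ^ (-α) * Real.exp (-(δV * tdistT (MP (paramsOf d L mT k hL)) y y')))) :
    ∃ δ C : ℝ, 0 < δ ∧ 0 < C ∧ ∀ (mT k m : ℕ) (hk : 1 ≤ k),
      HasMaj (BlockNorm.ofBlocks (unitTorusGeo L k (MP (paramsOf d L mT k hL))) (blkFine L k (MP (paramsOf d L mT k hL))))
        (BlockNorm.ofBlocks (unitTorusGeo L k (MP (paramsOf d L mT k hL))) (blkFine L k (MP (paramsOf d L mT k hL)) ∘ kingPrV L k m (MP (paramsOf d L mT k hL))))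
        (idef (pull (kingPrV L k m (MP (paramsOf d L mT k hL)))) (pull (kingPrV L k m (MP (paramsOf d L mT k hL))))
          (gOp (MP (paramsOf d L mT k hL)) (L ^ m * L ^ k) a) (gOp (MP (paramsOf d L mT k hL)) (L ^ k) a))
        (fun y y' => C * ((L ^ k : ℕ) : ℝ) ^ (-α) * Real.exp (-(δ * tdistT (MP (paramsOf d L mT k hL)) y y'))) := by
  obtain ⟨δ, C, hδ, hC, H⟩ := hasMaj_twoGridDefect_of_landau (d := d) hL ha hα0 hα1 hδV hCV hV
  refine ⟨δ, C, hδ, hC, fun mT k m hk => ?_⟩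
  rw [blkFine_comp_kingPrV]
  exact H mT k m hk

end Entry0

end Summit.QuantumFields.YangMills.BalabanUVNodes.N15.TwoGrid
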